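import Summits.AnomalousDissipation.AnomalousDissipation.Theses.TaylorCertificates
import Summits.AnomalousDissipation.AnomalousDissipation.Theorems.TaylorCertificatesTargetImpliesSteadyDirect

/-!
# `TaylorCertificates.Assembly` (stmt-AnomalousDissipation-14089): proof

`Summit.AnomalousDissipation.AnomalousDissipation.Theses.TaylorCertificates.Assembly` is the assembly
item of route `AnomalousDissipation/TaylorCertificates` (rev 3 chain):
`FloorCertificateEnsembleCeiling → FloorTransfer → EnsembleCeilingTransfer → ZeroDatumLerayHopf →
AnomalousDissipation`.
When this item was first closed its body was, verbatim, the type of the route's planner-authored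
deciding theorem `closes` (D-0027 §2.1), and the proof re-applied `closes` to the four hypotheses.
Since route rev 18 the deciding theorem is CRUX-ONLY,
`Summit.AnomalousDissipation.AnomalousDissipation.Theses.TaylorCertificates.closes :
SteadyStatesLoudBounded → AnomalousDissipation` (Temam's steady weak solutions along `ν_j = ν₀/(j+2)`,
made classical steady states by the steady/classical bridge and global Leray–Hopf solutions by the
landed MirrorVariety result, are loud and bounded by item #3), so the assembly is now settled by the
shorter chain through item #3: the target `X = FloorCertificateEnsembleCeiling` implies
`SteadyStatesLoudBounded` for the same force and constants (route item `TargetImpliesSteady`,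
stmt-AnomalousDissipation-14883, closed by the landed
`Summit.AnomalousDissipation.AnomalousDissipation.Theorems.TargetImpliesSteady_direct_proof`:
at a smooth classical steady state the generator pairing and the energy channel vanish, so the FLOOR
reads `ε₀ ≤ ν‖∇u‖²`, and the Dirac mass at it is a stationary statistical solution, so the CEILING
gives `∫|u|² ≤ E`), and `closes` finishes. The three transfer hypotheses (`FloorTransfer`,
`EnsembleCeilingTransfer`, `ZeroDatumLerayHopf`, all closed items of the route) are no longer needed
by this implication and are discarded; nothing else is proved here.
Sources of the route step: Foias–Manley–Rosa–Temam 2001 (statistical solutions), Temam 1979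
(steady weak solutions), Hopf 1951.
-/

-- `Summit.<Summit>.<Problem>` is the tree's mandated summit-side namespace (CONVENTIONS §2); for this
-- single-conjunct summit the two coincide, so the duplicate is deliberate.
set_option linter.dupNamespace false

namespace Summit.AnomalousDissipation.AnomalousDissipation.Theorems

/-- **Assembly of route `TaylorCertificates`** (item stmt-AnomalousDissipation-14089):
`FloorCertificateEnsembleCeiling → FloorTransfer → EnsembleCeilingTransfer → ZeroDatumLerayHopf →
AnomalousDissipation`.
Proof: the target `X = FloorCertificateEnsembleCeiling` gives `SteadyStatesLoudBounded` for the same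
force (`TargetImpliesSteady_direct_proof`, item stmt-AnomalousDissipation-14883), and the route's
deciding theorem `Summit.AnomalousDissipation.AnomalousDissipation.Theses.TaylorCertificates.closes`
(rev 18: `SteadyStatesLoudBounded → AnomalousDissipation`) concludes; the three transfer hypotheses
are not used. [route AnomalousDissipation/TaylorCertificates; FoiasManleyRosaTemam2001; Temam1979;
Hopf1951] -/
theorem taylorCertificates_assembly_proof :
    Summit.AnomalousDissipation.AnomalousDissipation.Theses.TaylorCertificates.Assembly := by
  unfold Summit.AnomalousDissipation.AnomalousDissipation.Theses.TaylorCertificates.Assembly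
  intro hX _hFloor _hCeiling _hZero
  exact Summit.AnomalousDissipation.AnomalousDissipation.Theses.TaylorCertificates.closes
    (Summit.AnomalousDissipation.AnomalousDissipation.Theorems.TargetImpliesSteady_direct_proof hX)

end Summit.AnomalousDissipation.AnomalousDissipation.Theorems
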